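import Literature.NumberTheory.Automorphic.FiniteAdeleFactorizable
import Literature.NumberTheory.Automorphic.AdelicSecondCountable
import Literature.NumberTheory.Automorphic.AdicCompletionLocalField
import Literature.MeasureTheory.RestrictedProduct.CylinderSlices
import Mathlib.MeasureTheory.Integral.Pi
import HarnessLib

/-!
# Integrals of pure tensors over `(𝔸_{K,f})^ι` factor over the finite places

Topic `NumberTheory/Automorphic`; namespace `Literature.NumberTheory.Automorphic` (sequel of
`FiniteAdeleFactorizable.lean`: `LocalSBFamily`, `piProd`, `unitVec`, `integralBox`, `offBox`).

Sources.  J. Tate, *Fourier analysis in number fields and Hecke's zeta-functions* (thesis 1950;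
Cassels–Fröhlich 1967, Ch. XV) [TateThesis1967], §3.3 (the restricted direct product measure
`dμ = ∏_v dμ_v`, `μ_v(𝒪_v) = 1` for almost all `v`) and Theorem 3.3.1: for `f(x) = ∏_v f_v(x_v)` with
`f_v` continuous, integrable and `f_v = 1_{𝒪_v}` for almost all `v`,
`∫ f dμ = ∏_v ∫ f_v dμ_v`; A. Guichardet, *Symmetric Hilbert Spaces and Related Topics*, LNM 261
(1972) [Guichardet1972], App. D.3 (the restricted product measure is determined by its slices over
the cylinders, which are the finite product measures — tree port
`Literature/MeasureTheory/RestrictedProduct/CylinderSlices.lean`, `ProdL2.measurePreserving_evalT`);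
D. Bump, *Automorphic Forms and Representations* (1997) [Bump1997], §3.3–§3.5 (restricted tensor
products `⊗'_v`, the inner product of pure tensors is the product of the local inner products).

WHAT IS PROVED (kernel, Mathlib + tree only; no cited statement is assumed).  Let `K` be a number
field, `ι` a finite type, `μ` an additive Haar measure on `(𝔸_{K,f})^ι = ι → FiniteAdeleRing (𝓞 K) K`
(product Borel structure) and `ν_v` additive Haar measures on the local spaces `K_v^ι`.

* `integral_indicator_offBox_prod_eq` (the engine): for a finite set of places `T` and continuous
  local functions `F_v : K_v^ι → ℂ`,
  `∫ 1_{offBox T}(x) · ∏_{v ∈ T} F_v(x_v) dμ(x) = μ(𝒪̂^ι) • ∏_{v ∈ T} ν_v(𝒪_v^ι)⁻¹ • ∫ F_v dν_v`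
  (`offBox T` = integral off `T`, `𝒪̂^ι = offBox ∅`).  Proof: transpose `(𝔸_{K,f})^ι` to the
  restricted product `Πʳ_v [K_v^ι, 𝒪_v^ι]` (a homeomorphic additive isomorphism, by the universal
  properties `RestrictedProduct.continuous_dom_pi` ∕ `continuous_dom` of Mathlib), transport `μ`,
  normalise, and read the slice over the cylinder `X_(T)` through `ProdL2.measurePreserving_evalT`
  and Fubini on the finite product (`integral_fintype_prod_eq_prod`).
* `integral_piProd_eq`: `∫ (∏_v Φ_v) dμ = μ(𝒪̂^ι) • ∏_{v ∈ T} ν_v(𝒪_v^ι)⁻¹ • ∫ Φ_v dν_v` for a pure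
  tensor `Φ = (Φ_v)_v` with `Φ_v = 1_{𝒪_v^ι}` off `T` (Tate 3.3.1 for Schwartz–Bruhat pure tensors).
* `integral_piProd_mul_conj_piProd_eq`: **the `L²`-pairing of two pure tensors is the product of
  the local pairings**, `∫ (∏_v Φ_v) conj(∏_v Ψ_v) dμ = μ(𝒪̂^ι) • ∏_{v∈T} ν_v(𝒪_v^ι)⁻¹ • ∫ Φ_v conj Ψ_v dν_v`
  (Bump §3.5), and the normalised forms `…_of_measure_eq_one` (`μ(𝒪̂^ι) = 1`, `ν_v(𝒪_v^ι) = 1` on `T`):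
  `⟨∏Φ_v, ∏Ψ_v⟩ = ∏_{v ∈ T} ⟨Φ_v, Ψ_v⟩_v`.
* `isCompact_offBox_empty`, `measure_offBox_empty_pos`, `measure_offBox_empty_lt_top`: the total
  integral box `𝒪̂^ι` is compact open, of positive finite Haar measure.

No definitions are introduced (the transposition and the subgroup structure on the boxes are local
to the proofs).
-/

open scoped RestrictedProduct ENNReal NNReal ComplexConjugate
open Filter Function Set IsDedekindDomain NumberField MeasureTheory MeasureTheory.Measure Topology
open Literature.MeasureTheory.RestrictedProduct

noncomputable section

namespace Literature.NumberTheory.Automorphic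

section Box

variable (K : Type) [Field K] [NumberField K] (ι : Type)

/-- The total integral box `𝒪̂^ι = offBox ∅ = {x | x_i ∈ 𝒪_v ∀ i ∀ v}` of `(𝔸_{K,f})^ι` is compact
(a closed subset of the compact `∏_i ∏_v 𝒪_v`). [cite: TateThesis1967, §3.1–§3.3] -/
theorem isCompact_offBox_empty : IsCompact (offBox (K := K) (ι := ι) ∅) := by
  have hO : IsCompact {a : FiniteAdeleRing (𝓞 K) K |
      ∀ v, a v ∈ (v.adicCompletionIntegers K : Set (v.adicCompletion K))} :=
    RestrictedProduct.isCompact_box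
      (fun v => isCompact_iff_compactSpace.mpr (compactSpace_adicCompletionIntegers' K v))
      (Eventually.of_forall fun _ => subset_rfl)
  refine (isCompact_univ_pi fun _ : ι => hO).of_isClosed_subset (isClosed_offBox ∅) ?_
  intro x hx i _ v
  exact hx i v (Finset.notMem_empty v)

variable [MeasurableSpace (FiniteAdeleRing (𝓞 K) K)]

/-- The total integral box has finite Haar measure (it is compact). [cite: TateThesis1967, §3.3] -/
theorem measure_offBox_empty_lt_top (μ : Measure (ι → FiniteAdeleRing (𝓞 K) K))
    [μ.IsAddHaarMeasure] : μ (offBox (ι := ι) ∅) < ∞ :=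
  (isCompact_offBox_empty K ι).measure_lt_top

variable [Finite ι]

/-- The total integral box has positive Haar measure (it is open and contains `0`).
[cite: TateThesis1967, §3.3] -/
theorem measure_offBox_empty_pos (μ : Measure (ι → FiniteAdeleRing (𝓞 K) K))
    [μ.IsAddHaarMeasure] : 0 < μ (offBox (ι := ι) ∅) :=
  (isOpen_offBox ∅).measure_pos μ ⟨0, fun _ v _ => zero_mem (v.adicCompletionIntegers K)⟩

end Box

section Integral

variable (K : Type) [Field K] [NumberField K] (ι : Type) [Finite ι]
  [MeasurableSpace (FiniteAdeleRing (𝓞 K) K)] [BorelSpace (FiniteAdeleRing (𝓞 K) K)]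
  [∀ v : HeightOneSpectrum (𝓞 K), MeasurableSpace (v.adicCompletion K)]
  [∀ v : HeightOneSpectrum (𝓞 K), BorelSpace (v.adicCompletion K)]

/-- **Integrals of finite products over the places factor** (the measure-theoretic core of the
restricted tensor product `𝒮((𝔸_{K,f})^ι) = ⊗'_v 𝒮(K_v^ι)`; Tate's restricted product measure,
Guichardet's slices): for an additive Haar measure `μ` on `(𝔸_{K,f})^ι`, additive Haar measures
`ν_v` on the `K_v^ι`, a finite set of places `T` and continuous `F_v : K_v^ι → ℂ` (`v ∈ T`),
`∫ 1_{offBox T}(x) ∏_{v ∈ T} F_v(x_v) dμ(x) = μ(𝒪̂^ι) • ∏_{v ∈ T} ν_v(𝒪_v^ι)⁻¹ • ∫ F_v dν_v`.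
[cite: TateThesis1967, Thm 3.3.1] [cite: Guichardet1972, App. D.3] -/
theorem integral_indicator_offBox_prod_eq
    (μ : Measure (ι → FiniteAdeleRing (𝓞 K) K)) [μ.IsAddHaarMeasure]
    (ν : ∀ v : HeightOneSpectrum (𝓞 K), Measure (ι → v.adicCompletion K))
    [∀ v, (ν v).IsAddHaarMeasure] (T : Finset (HeightOneSpectrum (𝓞 K)))
    (F : ∀ v : HeightOneSpectrum (𝓞 K), (ι → v.adicCompletion K) → ℂ)
    (hF : ∀ v ∈ T, Continuous (F v)) :
    ∫ x, (offBox T).indicator (fun x => ∏ v ∈ T, F v fun i => x i v) x ∂μ =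
      (μ (offBox (ι := ι) ∅)).toReal •
        ∏ v ∈ T, ((ν v (integralBox K ι v)).toReal⁻¹ • ∫ z, F v z ∂ν v) := by
  classical
  /- instances on the local and adelic spaces -/
  haveI : SecondCountableTopology (FiniteAdeleRing (𝓞 K) K) :=
    secondCountableTopology_finiteAdeleRing K
  haveI : ∀ v : HeightOneSpectrum (𝓞 K), SecondCountableTopology (v.adicCompletion K) :=
    fun v => secondCountableTopology_adicCompletion K v
  /- the integral boxes as additive subgroups -/
  let C : ∀ v : HeightOneSpectrum (𝓞 K), AddSubgroup (ι → v.adicCompletion K) := fun v =>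
    AddSubgroup.pi Set.univ fun _ => (v.adicCompletionIntegers K).toSubring.toAddSubgroup
  have hCmem : ∀ v (z : ι → v.adicCompletion K),
      z ∈ C v ↔ ∀ i, z i ∈ v.adicCompletionIntegers K := by
    intro v z
    simp [C, AddSubgroup.mem_pi]
  have hCcoe : ∀ v, (C v : Set (ι → v.adicCompletion K)) = integralBox K ι v := fun v =>
    Set.ext fun z => (hCmem v z).trans mem_integralBox_iff.symm
  haveI hCo : Fact (∀ v, IsOpen (C v : Set (ι → v.adicCompletion K))) :=
    ⟨fun v => by rw [hCcoe]; exact isOpen_integralBox K ι v⟩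
  haveI hCc : ∀ v, CompactSpace (C v) := fun v =>
    isCompact_iff_compactSpace.mp (by rw [hCcoe]; exact isCompact_integralBox K ι v)
  letI : MeasurableSpace (Πʳ v : HeightOneSpectrum (𝓞 K), [ι → v.adicCompletion K, C v]) :=
    borel _
  haveI : BorelSpace (Πʳ v : HeightOneSpectrum (𝓞 K), [ι → v.adicCompletion K, C v]) := ⟨rfl⟩
  /- the transposition `(x_i)_i ↦ (((x_i)_v)_i)_v`, an additive isomorphism onto the restricted
  product of the local tuples -/
  let e : (ι → FiniteAdeleRing (𝓞 K) K) ≃+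
      Πʳ v : HeightOneSpectrum (𝓞 K), [ι → v.adicCompletion K, C v] :=
    { toFun := fun x => ⟨fun v i => x i v,
        (eventually_all.mpr fun i => (x i).2).mono fun v hv => (hCmem v _).mpr hv⟩
      invFun := fun y i => ⟨fun v => y v i, y.2.mono fun v hv => (hCmem v _).mp hv i⟩
      left_inv := fun _ => rfl
      right_inv := fun _ => rfl
      map_add' := fun _ _ => rfl }
  /- `e` is continuous: finitary universal property of `(𝔸_{K,f})^ι = ∏_i Πʳ_v [K_v, 𝒪_v]` -/
  have he : Continuous e := by
    have hO : ∀ (_ : ι) (v : HeightOneSpectrum (𝓞 K)),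
        IsOpen ((v.adicCompletionIntegers K : Set (v.adicCompletion K))) :=
      fun _ v => Valued.isOpen_valuationSubring _
    refine (RestrictedProduct.continuous_dom_pi hO).mpr fun S hS => ?_
    let g : (ι → Πʳ v : HeightOneSpectrum (𝓞 K), [v.adicCompletion K,
          (v.adicCompletionIntegers K : Set (v.adicCompletion K))]_[𝓟 S]) →
        Πʳ v : HeightOneSpectrum (𝓞 K), [ι → v.adicCompletion K,
          (C v : Set (ι → v.adicCompletion K))]_[𝓟 S] :=
      fun x => ⟨fun v i => x i v,
        (eventually_all.mpr fun i => (x i).2).mono fun v hv => (hCmem v _).mpr hv⟩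
    have hg : Continuous g :=
      RestrictedProduct.continuous_rng_of_principal.mpr
        (continuous_pi fun v => continuous_pi fun i =>
          (RestrictedProduct.continuous_eval v).comp (continuous_apply i))
    exact Continuous.congr ((RestrictedProduct.continuous_inclusion hS).comp hg) fun _ => rfl
  /- `e⁻¹` is continuous: universal property of the restricted product, coordinatewise -/
  have hes : Continuous e.symm := by
    refine continuous_pi fun i => ?_
    refine (RestrictedProduct.continuous_dom
      (f := fun y : Πʳ v : HeightOneSpectrum (𝓞 K), [ι → v.adicCompletion K, C v] =>
        e.symm y i)).mpr fun S hS => ?_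
    let d : (Πʳ v : HeightOneSpectrum (𝓞 K), [ι → v.adicCompletion K,
          (C v : Set (ι → v.adicCompletion K))]_[𝓟 S]) →
        Πʳ v : HeightOneSpectrum (𝓞 K), [v.adicCompletion K,
          (v.adicCompletionIntegers K : Set (v.adicCompletion K))]_[𝓟 S] :=
      fun y => ⟨fun v => y v i, y.2.mono fun v hv => (hCmem v _).mp hv i⟩
    have hd : Continuous d :=
      RestrictedProduct.continuous_rng_of_principal.mpr
        (continuous_pi fun v => (continuous_apply i).comp (RestrictedProduct.continuous_eval v))
    exact Continuous.congr ((RestrictedProduct.continuous_inclusion hS).comp hd) fun _ => rfl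
  let eM : (ι → FiniteAdeleRing (𝓞 K) K) ≃ᵐ
      Πʳ v : HeightOneSpectrum (𝓞 K), [ι → v.adicCompletion K, C v] :=
    { e.toEquiv with measurable_toFun := he.measurable, measurable_invFun := hes.measurable }
  have heM : (eM : (ι → FiniteAdeleRing (𝓞 K) K) →
      Πʳ v : HeightOneSpectrum (𝓞 K), [ι → v.adicCompletion K, C v]) = e := rfl
  /- normalisation constants -/
  have hc₀pos : μ (offBox (ι := ι) ∅) ≠ 0 := (measure_offBox_empty_pos K ι μ).ne'
  have hc₀top : μ (offBox (ι := ι) ∅) ≠ ∞ := (measure_offBox_empty_lt_top K ι μ).ne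
  have hbpos : ∀ v, ν v (integralBox K ι v) ≠ 0 := fun v =>
    ((isOpen_integralBox K ι v).measure_pos (ν v) ⟨0, zero_mem_integralBox K ι v⟩).ne'
  have hbtop : ∀ v, ν v (integralBox K ι v) ≠ ∞ := fun v =>
    (isCompact_integralBox K ι v).measure_lt_top.ne
  /- normalised measures -/
  set μ₁ : Measure (ι → FiniteAdeleRing (𝓞 K) K) := (μ (offBox (ι := ι) ∅))⁻¹ • μ with hμ₁
  haveI : μ₁.IsAddHaarMeasure :=
    IsAddHaarMeasure.smul μ (ENNReal.inv_ne_zero.mpr hc₀top) (ENNReal.inv_ne_top.mpr hc₀pos)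
  have hμ : μ = μ (offBox (ι := ι) ∅) • μ₁ := by
    rw [hμ₁, smul_smul, ENNReal.mul_inv_cancel hc₀pos hc₀top, one_smul]
  let m : ∀ v : HeightOneSpectrum (𝓞 K), Measure (ι → v.adicCompletion K) :=
    fun v => (ν v (integralBox K ι v))⁻¹ • ν v
  haveI hmH : ∀ v, (m v).IsAddHaarMeasure := fun v =>
    IsAddHaarMeasure.smul (ν v) (ENNReal.inv_ne_zero.mpr (hbtop v))
      (ENNReal.inv_ne_top.mpr (hbpos v))
  have hm1 : ∀ v, m v (C v) = 1 := fun v => by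
    simp only [m, Measure.smul_apply, smul_eq_mul, hCcoe]
    exact ENNReal.inv_mul_cancel (hbpos v) (hbtop v)
  /- the transported normalised measure on the restricted product -/
  set μ' : Measure (Πʳ v : HeightOneSpectrum (𝓞 K), [ι → v.adicCompletion K, C v]) :=
    μ₁.map e with hμ'
  haveI : μ'.IsAddHaarMeasure := e.isAddHaarMeasure_map μ₁ he hes
  have hpre_box : e ⁻¹' (ProdL2.boxSet C) = offBox (ι := ι) ∅ := by
    ext x
    constructor
    · intro hx i v _
      exact ((hCmem v _).mp (hx v)) i
    · intro hx v
      exact (hCmem v _).mpr fun i => hx i v (Finset.notMem_empty v)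
  have hμ'box : μ' (ProdL2.boxSet C) = 1 := by
    rw [hμ', Measure.map_apply he.measurable ProdL2.isOpen_boxSet.measurableSet, hpre_box,
      hμ₁, Measure.smul_apply, smul_eq_mul, ENNReal.inv_mul_cancel hc₀pos hc₀top]
  have hMP := ProdL2.measurePreserving_evalT (C := C) m μ' hμ'box hm1 T
  /- the integrand is the pull-back of the cylinder indicator times the product function -/
  let Fpi : (∀ w : T, (ι → (w : HeightOneSpectrum (𝓞 K)).adicCompletion K)) → ℂ :=
    fun z => ∏ w : T, F w.1 (z w)
  have hFpi : Continuous Fpi :=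
    continuous_finsetProd _ fun w _ => (hF w.1 w.2).comp (continuous_apply w)
  have hpre_cyl : e ⁻¹' (ProdL2.cylSet C T) = offBox (ι := ι) T := by
    ext x
    constructor
    · intro hx i v hv
      exact ((hCmem v _).mp (hx v hv)) i
    · intro hx v hv
      exact (hCmem v _).mpr fun i => hx i v hv
  have hfun : (Fpi ∘ ProdL2.evalT C T) ∘ e = fun x => ∏ v ∈ T, F v fun i => x i v := by
    funext x
    exact Finset.prod_coe_sort (s := T) (f := fun v => F v fun i => x i v)
  have hint : (fun x => (offBox T).indicator (fun x => ∏ v ∈ T, F v fun i => x i v) x) =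
      fun x => (ProdL2.cylSet C T).indicator (Fpi ∘ ProdL2.evalT C T) (eM x) := by
    funext x
    rw [heM, ← indicator_comp_right e, hpre_cyl, hfun]
  /- the computation -/
  rw [hint, ← integral_map_equiv eM]
  conv_lhs => rw [hμ, Measure.map_smul, integral_smul_measure]
  rw [heM, ← hμ', integral_indicator (ProdL2.isOpen_cylSet T).measurableSet]
  congr 1
  calc ∫ y in ProdL2.cylSet C T, (Fpi ∘ ProdL2.evalT C T) y ∂μ'
      = ∫ z, Fpi z ∂(Measure.pi fun w : T => m w.1) := by
        rw [← hMP.map_eq]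
        exact (integral_map (ProdL2.continuous_evalT (C := C) T).measurable.aemeasurable
          hFpi.aestronglyMeasurable).symm
    _ = ∏ w : T, ∫ z, F w.1 z ∂(m w.1) :=
        integral_fintype_prod_eq_prod (fun w : T => F w.1)
    _ = ∏ v ∈ T, ((ν v (integralBox K ι v)).toReal⁻¹ • ∫ z, F v z ∂ν v) := by
        rw [Finset.prod_coe_sort (s := T) (f := fun v => ∫ z, F v z ∂(m v))]
        refine Finset.prod_congr rfl fun v _ => ?_
        change ∫ z, F v z ∂((ν v (integralBox K ι v))⁻¹ • ν v) = _
        rw [integral_smul_measure, ENNReal.toReal_inv]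

/-- **Tate's theorem 3.3.1 for Schwartz–Bruhat pure tensors**: for a restricted family
`Φ = (Φ_v)_v` of local Schwartz–Bruhat functions with `Φ_v = 1_{𝒪_v^ι}` off the finite set `T`,
`∫_{(𝔸_{K,f})^ι} (∏_v Φ_v) dμ = μ(𝒪̂^ι) • ∏_{v ∈ T} ν_v(𝒪_v^ι)⁻¹ • ∫_{K_v^ι} Φ_v dν_v`.
[cite: TateThesis1967, Thm 3.3.1] -/
theorem integral_piProd_eq
    (μ : Measure (ι → FiniteAdeleRing (𝓞 K) K)) [μ.IsAddHaarMeasure]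
    (ν : ∀ v : HeightOneSpectrum (𝓞 K), Measure (ι → v.adicCompletion K))
    [∀ v, (ν v).IsAddHaarMeasure] (Φ : LocalSBFamily K ι) (T : Finset (HeightOneSpectrum (𝓞 K)))
    (hΦ : ∀ v ∉ T, Φ v = unitVec K ι v) :
    ∫ x, piProd K ι Φ x ∂μ =
      (μ (offBox (ι := ι) ∅)).toReal • ∏ v ∈ T, ((ν v (integralBox K ι v)).toReal⁻¹ •
        ∫ z, (Φ v : (ι → v.adicCompletion K) → ℂ) z ∂ν v) := by
  rw [piProd_eq_indicator Φ T hΦ]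
  exact integral_indicator_offBox_prod_eq K ι μ ν T
    (fun v => ((Φ v : ↥(SchwartzBruhat (ι → v.adicCompletion K))) : (ι → v.adicCompletion K) → ℂ))
    fun v _ => (mem_schwartzBruhat_iff.mp (Φ v).2).1.continuous

/-- **The `L²`-pairing of two pure tensors is the product of the local pairings** (the inner
product of the restricted tensor product `⊗'_v 𝒮(K_v^ι)`): for restricted families `Φ`, `Ψ` with
`Φ_v = Ψ_v = 1_{𝒪_v^ι}` off `T`,
`∫ (∏_v Φ_v)(x) conj((∏_v Ψ_v)(x)) dμ(x) = μ(𝒪̂^ι) • ∏_{v ∈ T} ν_v(𝒪_v^ι)⁻¹ • ∫ Φ_v conj(Ψ_v) dν_v`.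
[cite: Bump1997, §3.5] [cite: TateThesis1967, Thm 3.3.1] -/
theorem integral_piProd_mul_conj_piProd_eq
    (μ : Measure (ι → FiniteAdeleRing (𝓞 K) K)) [μ.IsAddHaarMeasure]
    (ν : ∀ v : HeightOneSpectrum (𝓞 K), Measure (ι → v.adicCompletion K))
    [∀ v, (ν v).IsAddHaarMeasure] (Φ Ψ : LocalSBFamily K ι)
    (T : Finset (HeightOneSpectrum (𝓞 K)))
    (hΦ : ∀ v ∉ T, Φ v = unitVec K ι v) (hΨ : ∀ v ∉ T, Ψ v = unitVec K ι v) :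
    ∫ x, piProd K ι Φ x * conj (piProd K ι Ψ x) ∂μ =
      (μ (offBox (ι := ι) ∅)).toReal • ∏ v ∈ T, ((ν v (integralBox K ι v)).toReal⁻¹ •
        ∫ z, (Φ v : (ι → v.adicCompletion K) → ℂ) z *
          conj ((Ψ v : (ι → v.adicCompletion K) → ℂ) z) ∂ν v) := by
  have hfun : (fun x => piProd K ι Φ x * conj (piProd K ι Ψ x)) =
      fun x => (offBox T).indicator (fun x => ∏ v ∈ T,
        ((Φ v : (ι → v.adicCompletion K) → ℂ) fun i => x i v) *
          conj ((Ψ v : (ι → v.adicCompletion K) → ℂ) fun i => x i v)) x := by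
    funext x
    rw [piProd_eq_indicator Φ T hΦ, piProd_eq_indicator Ψ T hΨ]
    by_cases hx : x ∈ offBox T
    · simp only [indicator_of_mem hx, localFactor_apply, map_prod, ← Finset.prod_mul_distrib]
    · simp only [indicator_of_notMem hx, zero_mul]
  rw [hfun]
  exact integral_indicator_offBox_prod_eq K ι μ ν T
    (fun v z => (Φ v : (ι → v.adicCompletion K) → ℂ) z *
      conj ((Ψ v : (ι → v.adicCompletion K) → ℂ) z))
    fun v _ => (mem_schwartzBruhat_iff.mp (Φ v).2).1.continuous.mul
      (Complex.continuous_conj.comp (mem_schwartzBruhat_iff.mp (Ψ v).2).1.continuous)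

/-- Normalised form of `integral_piProd_eq`: if `μ(𝒪̂^ι) = 1` and `ν_v(𝒪_v^ι) = 1` for `v ∈ T`, then
`∫ (∏_v Φ_v) dμ = ∏_{v ∈ T} ∫ Φ_v dν_v`. [cite: TateThesis1967, Thm 3.3.1] -/
theorem integral_piProd_eq_of_measure_eq_one
    (μ : Measure (ι → FiniteAdeleRing (𝓞 K) K)) [μ.IsAddHaarMeasure]
    (ν : ∀ v : HeightOneSpectrum (𝓞 K), Measure (ι → v.adicCompletion K))
    [∀ v, (ν v).IsAddHaarMeasure] (hμ : μ (offBox (ι := ι) ∅) = 1)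
    (T : Finset (HeightOneSpectrum (𝓞 K))) (hν : ∀ v ∈ T, ν v (integralBox K ι v) = 1)
    (Φ : LocalSBFamily K ι) (hΦ : ∀ v ∉ T, Φ v = unitVec K ι v) :
    ∫ x, piProd K ι Φ x ∂μ = ∏ v ∈ T, ∫ z, (Φ v : (ι → v.adicCompletion K) → ℂ) z ∂ν v := by
  rw [integral_piProd_eq K ι μ ν Φ T hΦ, hμ, ENNReal.toReal_one, one_smul]
  exact Finset.prod_congr rfl fun v hv => by rw [hν v hv, ENNReal.toReal_one, inv_one, one_smul]

/-- Normalised form of `integral_piProd_mul_conj_piProd_eq`: if `μ(𝒪̂^ι) = 1` and `ν_v(𝒪_v^ι) = 1`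
for `v ∈ T`, the pairing of two pure tensors unramified off `T` is the finite product of the local
pairings, `⟨∏_v Φ_v, ∏_v Ψ_v⟩ = ∏_{v ∈ T} ⟨Φ_v, Ψ_v⟩_v`. [cite: Bump1997, §3.5]
[cite: TateThesis1967, Thm 3.3.1] -/
theorem integral_piProd_mul_conj_piProd_eq_of_measure_eq_one
    (μ : Measure (ι → FiniteAdeleRing (𝓞 K) K)) [μ.IsAddHaarMeasure]
    (ν : ∀ v : HeightOneSpectrum (𝓞 K), Measure (ι → v.adicCompletion K))
    [∀ v, (ν v).IsAddHaarMeasure] (hμ : μ (offBox (ι := ι) ∅) = 1)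
    (T : Finset (HeightOneSpectrum (𝓞 K))) (hν : ∀ v ∈ T, ν v (integralBox K ι v) = 1)
    (Φ Ψ : LocalSBFamily K ι)
    (hΦ : ∀ v ∉ T, Φ v = unitVec K ι v) (hΨ : ∀ v ∉ T, Ψ v = unitVec K ι v) :
    ∫ x, piProd K ι Φ x * conj (piProd K ι Ψ x) ∂μ =
      ∏ v ∈ T, ∫ z, (Φ v : (ι → v.adicCompletion K) → ℂ) z *
        conj ((Ψ v : (ι → v.adicCompletion K) → ℂ) z) ∂ν v := by
  rw [integral_piProd_mul_conj_piProd_eq K ι μ ν Φ Ψ T hΦ hΨ, hμ, ENNReal.toReal_one, one_smul]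
  exact Finset.prod_congr rfl fun v hv => by rw [hν v hv, ENNReal.toReal_one, inv_one, one_smul]

end Integral

end Literature.NumberTheory.Automorphic
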